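import Summits.AtomisticToContinuum.HydrodynamicLimit.Theses.AntiMazurCoboundaries
import Literature.MathematicalPhysics.KineticTheory.HardSphereEulerProofs
import Literature.MathematicalPhysics.KineticTheory.HardSphereUniformGas

/-!
# One-velocity resampling identity under the homogeneous Gibbs law (sub-stub W5 of the line `cutoff-compactness-net`)

Registered sub-stub `stub_resamplingOrthogonality` of the crux `AntiMazurCoboundaries.ShearStressHalfDrude`
(stmt-AtomisticToContinuum-14136). Under the homogeneous Gibbs law
`G_N = localGibbsLaw σ a u₀ θ N Φ` (constant profiles) the velocity of particle `i` is
`N(u₀, θ id)`-distributed INDEPENDENTLY of the positions and of the other velocities, so a centred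
observable `k((vᵢ − u₀)/√θ)` of it is orthogonal to every functional
`z ↦ ∫ Ψ(z^{(i ← v')}) N(u₀, θ id)(dv')` of the configuration with velocity `i` redrawn:
`∫ G_N(dz) ∫ N(u₀, θ id)(dv') k((vᵢ − u₀)/√θ) Ψ(update z i (xᵢ, v')) = 0`.

Proof. The rung-0 product structure `G_N = zipConfig_# (posGibbsMeasure ⊗ ⊗ᵢ N(u₀, θ id))`
(`integral_localGibbsLaw_rung0` of `Literature/…/HardSphereUniformGas`) reduces the claim to a
statement about a product measure `P ⊗ μ^{⊗(N+1)}` (`integral_integral_update_eq_zero`): splitting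
off coordinate `i` of the velocity product by the measurable equivalence
`MeasurableEquiv.piFinSuccAbove` (`measurePreserving_piFinSuccAbove`; redrawing coordinate `i` of `v`
is inserting the new value into `removeNth i v`, `Fin.insertNth_removeNth`), the integrand becomes
`k((w − u₀)/√θ) · H(removeNth i v, x)` on `μ ⊗ (μ^{⊗N} ⊗ P)` and the product formula
`integral_prod_mul` gives `(∫ k((w − u₀)/√θ) N(u₀, θ id)(dw)) · (…) = (∫ k dγ) · (…) = 0`.
No integrability is needed: the change of variables along a measure-preserving equivalence and the
product formula hold for the Bochner integral unconditionally.
-/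

noncomputable section

namespace Summit.AtomisticToContinuum.HydrodynamicLimit.Theorems

open MeasureTheory ProbabilityTheory Filter Set
open scoped ENNReal InnerProductSpace BigOperators
open Literature.Analysis.FluidPDE Literature.MathematicalPhysics.KineticTheory

namespace ShearStressHalfDrudeResampling

/-- **Resampling one coordinate of a product measure kills centred factors.** On
`P ⊗ μ^{⊗(n+1)}` (`P` s-finite, `μ` σ-finite), for `f` with `∫ f dμ = 0` and an arbitrary `g`,
`∫ (P ⊗ μ^{⊗(n+1)})(dx, dv) ∫ μ(dy) f(vᵢ) g(x, update v i y) = 0`: after splitting off coordinate `i`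
(`piFinSuccAbove`) the integrand is `f(w) · H(removeNth i v, x)` and the product formula applies.
[folklore] -/
theorem integral_integral_update_eq_zero {X Y : Type*} [MeasurableSpace X] [MeasurableSpace Y]
    (P : Measure X) [SFinite P] (μ : Measure Y) [SigmaFinite μ] {n : ℕ} (i : Fin (n + 1))
    {f : Y → ℝ} (hf : ∫ y, f y ∂μ = 0) (g : X → (Fin (n + 1) → Y) → ℝ) :
    ∫ p, ∫ y, f (p.2 i) * g p.1 (Function.update p.2 i y) ∂μ
        ∂(P.prod (Measure.pi fun _ : Fin (n + 1) => μ)) = 0 := by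
  -- split off coordinate `i` of the product: `e v = (v i, removeNth i v)`
  set e := MeasurableEquiv.piFinSuccAbove (fun _ : Fin (n + 1) => Y) i with he
  have hme : MeasurePreserving e (Measure.pi fun _ : Fin (n + 1) => μ)
      (μ.prod (Measure.pi fun _ : Fin n => μ)) :=
    measurePreserving_piFinSuccAbove (fun _ : Fin (n + 1) => μ) i
  -- `E (x, v) = (v i, (removeNth i v, x))`
  set E : X × (Fin (n + 1) → Y) ≃ᵐ Y × ((Fin n → Y) × X) :=
    ((MeasurableEquiv.prodCongr (MeasurableEquiv.refl X) e).trans MeasurableEquiv.prodComm).trans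
      MeasurableEquiv.prodAssoc with hE
  have h1 : MeasurePreserving (MeasurableEquiv.prodCongr (MeasurableEquiv.refl X) e)
      (P.prod (Measure.pi fun _ : Fin (n + 1) => μ))
      (P.prod (μ.prod (Measure.pi fun _ : Fin n => μ))) :=
    (MeasurePreserving.id P).prod hme
  have h2 : MeasurePreserving
      (MeasurableEquiv.prodComm : X × (Y × (Fin n → Y)) ≃ᵐ (Y × (Fin n → Y)) × X)
      (P.prod (μ.prod (Measure.pi fun _ : Fin n => μ)))
      ((μ.prod (Measure.pi fun _ : Fin n => μ)).prod P) :=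
    Measure.measurePreserving_swap
  have h3 : MeasurePreserving
      (MeasurableEquiv.prodAssoc : (Y × (Fin n → Y)) × X ≃ᵐ Y × ((Fin n → Y) × X))
      ((μ.prod (Measure.pi fun _ : Fin n => μ)).prod P)
      (μ.prod ((Measure.pi fun _ : Fin n => μ).prod P)) :=
    measurePreserving_prodAssoc μ (Measure.pi fun _ : Fin n => μ) P
  have hmE : MeasurePreserving E (P.prod (Measure.pi fun _ : Fin (n + 1) => μ))
      (μ.prod ((Measure.pi fun _ : Fin n => μ).prod P)) :=
    (h1.trans h2).trans h3
  -- the conditional expectation of `g` given everything but coordinate `i`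
  set H : (Fin n → Y) × X → ℝ := fun q => ∫ y, g q.2 (Fin.insertNth i y q.1) ∂μ with hH
  have key : ∀ p : X × (Fin (n + 1) → Y),
      ∫ y, f (p.2 i) * g p.1 (Function.update p.2 i y) ∂μ = f (E p).1 * H (E p).2 := by
    rintro ⟨x, v⟩
    rw [integral_const_mul]
    show f (v i) * ∫ y, g x (Function.update v i y) ∂μ =
      f (v i) * ∫ y, g x (Fin.insertNth i y (Fin.removeNth i v)) ∂μ
    simp only [Fin.insertNth_removeNth]
  calc ∫ p, ∫ y, f (p.2 i) * g p.1 (Function.update p.2 i y) ∂μ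
          ∂(P.prod (Measure.pi fun _ : Fin (n + 1) => μ))
      = ∫ p, (fun q : Y × ((Fin n → Y) × X) => f q.1 * H q.2) (E p)
          ∂(P.prod (Measure.pi fun _ : Fin (n + 1) => μ)) :=
        integral_congr_ae (Eventually.of_forall key)
    _ = ∫ q, f q.1 * H q.2 ∂(μ.prod ((Measure.pi fun _ : Fin n => μ).prod P)) :=
        hmE.integral_comp' (fun q : Y × ((Fin n → Y) × X) => f q.1 * H q.2)
    _ = (∫ y, f y ∂μ) * ∫ q, H q ∂((Measure.pi fun _ : Fin n => μ).prod P) :=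
        integral_prod_mul f H
    _ = 0 := by rw [hf, zero_mul]

/-- **One-velocity resampling identity** (sub-stub W5 of the line `cutoff-compactness-net` of
`AntiMazurCoboundaries.ShearStressHalfDrude`): under the homogeneous hard-sphere Gibbs law with
constant profiles `(a, u₀, θ)`, a centred velocity observable `k((vᵢ − u₀)/√θ)` of particle `i`
(`∫ k dγ = 0`, `γ` the standard Gaussian) is orthogonal to every functional of the configuration
with velocity `i` redrawn from `N(u₀, θ id)`:
`∫ G_N(dz) ∫ N(u₀, θ id)(dv') k((vᵢ − u₀)/√θ) Ψ(update z i (xᵢ, v')) = 0`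
(velocity `i` is `N(u₀, θ id)` independently of the positions and the other velocities; the
measurability and boundedness hypotheses are not used). [folklore] -/
theorem stub_resamplingOrthogonality :
    ∀ (σ a θ : ℝ) (u₀ : V3), σ ≤ 1 / 2 → 0 < a → 0 < θ →
    ∀ (N : ℕ) (Φ : HardSphereFlow (Torus.geometry (Fin 3)) (hsDiameter σ N) (N + 1)) (i : Fin (N + 1))
      (k : V3 → ℝ), Measurable k → (∃ K : ℝ, ∀ v, |k v| ≤ K) →
      ∫ v, k v ∂stdGaussian V3 = 0 →
    ∀ (Ψ : Config (N + 1) (Fin 3) T3 → ℝ), Measurable Ψ → (∃ C : ℝ, ∀ z, |Ψ z| ≤ C) →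
      ∫ z, ∫ v', k ((Real.sqrt θ)⁻¹ • ((z i).2 - u₀)) * Ψ (Function.update z i ((z i).1, v'))
          ∂(gaussMeasure u₀ θ) ∂(localGibbsLaw σ (fun _ => a) (fun _ => u₀) (fun _ => θ) N Φ) = 0 := by
  intro σ a θ u₀ hσ ha hθ N Φ i k _ _ hk0 Ψ _ _
  haveI : IsProbabilityMeasure (posGibbsMeasure (fun _ : T3 => a) (hsDiameter σ N) (N + 1)) :=
    isProbabilityMeasure_posGibbsMeasure continuous_const (fun _ => ha) hσ N
  -- `k((w − u₀)/√θ)` is centred under `N(u₀, θ id)`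
  have hk' : ∫ w, k ((Real.sqrt θ)⁻¹ • (w - u₀)) ∂(gaussMeasure u₀ θ) = 0 := by
    rw [integral_gaussMeasure u₀ hθ, ← hk0]
    simp only [add_sub_cancel_left, smul_smul, inv_mul_cancel₀ (Real.sqrt_pos.2 hθ).ne', one_smul]
  -- redrawing velocity `i` of a zipped configuration redraws coordinate `i` of its velocity vector
  have hupd : ∀ (p : (Fin (N + 1) → T3) × (Fin (N + 1) → V3)) (v' : V3),
      Function.update (zipConfig p) i (p.1 i, v') = zipConfig (p.1, Function.update p.2 i v') := by
    intro p v'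
    funext j
    by_cases hj : j = i
    · subst hj
      simp only [Function.update_self, zipConfig_apply]
    · simp only [Function.update_of_ne hj, zipConfig_apply]
  rw [integral_localGibbsLaw_rung0 σ ha.le hθ u₀ N Φ]
  simp only [zipConfig_apply, hupd]
  exact integral_integral_update_eq_zero _ _ i hk' (fun x v => Ψ (zipConfig (x, v)))

end ShearStressHalfDrudeResampling

end Summit.AtomisticToContinuum.HydrodynamicLimit.Theorems

end
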